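import Literature.MathematicalPhysics.QuantumFieldTheory.QCDTransferMatrix
import Literature.Analysis.Matrix.SchoenbergKernelsProofs
import Literature.Analysis.Matrix.ExpAbsKernel

/-!
# The Wilson pure-gauge transfer kernel is a positive definite kernel
(crux `QuarksAsStableAction.StableActionBridge`, item stmt-QuantumFields-9737, line `Sketch`;
registered stubs `isPosDefKernel_re_trace_mul_conjTranspose` and `isPosDefKernel_gaugeSliceKernel`
of the lead skeleton — the gauge half, at kernel level, of the Lüscher / Osterwalder–Seiler
positivity of the transfer matrix)

In temporal gauge the one-step transfer kernel of Wilson's `SU(3)` lattice gauge theory on the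
spatial three-torus of side `S` is (Smit, *Introduction to Quantum Fields on a Lattice*, §4.6
(4.121)–(4.129); Lüscher, CMP 54 (1977))

  `K_β(U, U') = f(U) · exp(−β ∑ₗ (3 − Re tr(U_l U'_lᴴ))) · f(U')`,  `f = exp(−(β/2) S₃)`,

with `S₃` the Wilson action of the spatial plaquettes (`gaugeSliceKernel`). Smit (§4.7) shows that
the integral operator `T̂_U` it defines is positive by a character expansion. At the level of
kernels (Berg–Christensen–Ressel, *Harmonic Analysis on Semigroups*, Ch. 3 §1: `IsPosDefKernel`,
every finite Gram-type matrix is positive semidefinite) this is three lines of kernel algebra,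
carried out here for `β ≥ 0`:

* `isPosDefKernel_re_trace_mul_conjTranspose`: the real Frobenius pairing
  `Re tr(V Wᴴ) = ∑_{a,b} (Re V_ab · Re W_ab + Im V_ab · Im W_ab)` is a finite sum of kernels
  `g(V) g(W)`, hence positive definite (BCR 3.1.9 and 3.1.11);
* `isPosDefKernel_gaugeSliceKernel`: `K_β = (f ⊗ f) · e^{−3β|E|} · exp(β ∑ₗ Re tr(U_l U'_lᴴ))`;
  each `Re tr(U_l U'_lᴴ)` is the pull-back of the Frobenius kernel along the link evaluation
  `U ↦ U_l`, the sum over links and the factor `β ≥ 0` stay in the convex cone (BCR 3.1.11), the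
  exponential of a positive definite kernel is positive definite (BCR 3.1.14, via Schur's theorem),
  and multiplying by the positive constant `e^{−3β|E|}` and by the rank-one kernel `f(U) f(U')`
  (BCR 3.1.9, 3.1.12) keeps positive definiteness.

Pure theorem file (no definitions); uses only the proved kernel API of
`Literature/Analysis/Matrix/SchoenbergKernelsProofs.lean` and `IsPosDefKernel.comp` of
`Literature/Analysis/Matrix/ExpAbsKernel.lean`.
-/

noncomputable section

namespace Summit.QuantumFields.QCD.Cruxes.StableActionBridge.Sketch

open Literature.MathematicalPhysics.QuantumFieldTheory Literature.Analysis.Matrix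
open Literature.MathematicalPhysics.QuantumLattice
open scoped Matrix BigOperators

/-- **The real Frobenius pairing is a positive definite kernel.** For every `N`, the kernel
`(V, W) ↦ Re tr(V Wᴴ)` on `N × N` complex matrices is positive definite: expanding the trace,
`Re tr(V Wᴴ) = ∑_{a,b} Re(V_ab · conj W_ab) = ∑_{a,b} (Re V_ab Re W_ab + Im V_ab Im W_ab)`, a finite
sum of rank-one kernels `g(V) g(W)` (BCR 3.1.9), which is positive definite (BCR 3.1.11).
Equivalently: `∑ c_j c_k Re tr(V_j V_kᴴ) = ‖∑ c_j V_j‖_F² ≥ 0`. [folklore] -/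
theorem isPosDefKernel_re_trace_mul_conjTranspose : ∀ (N : ℕ), IsPosDefKernel (fun V W : Matrix (Fin N) (Fin N) ℂ => (V * Wᴴ).trace.re) := by
  intro N
  have e : (fun V W : Matrix (Fin N) (Fin N) ℂ => (V * Wᴴ).trace.re) =
      fun V W => ∑ a : Fin N, ∑ b : Fin N,
        ((V a b).re * (W a b).re + (V a b).im * (W a b).im) := by
    funext V W
    simp only [Matrix.trace, Matrix.diag_apply, Matrix.mul_apply, Matrix.conjTranspose_apply,
      Complex.re_sum, Complex.mul_re, Complex.star_def, Complex.conj_re, Complex.conj_im]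
    refine Finset.sum_congr rfl fun a _ => Finset.sum_congr rfl fun b _ => ?_
    ring
  rw [e]
  refine isPosDefKernel_finsetSum Finset.univ fun a _ => ?_
  refine isPosDefKernel_finsetSum Finset.univ fun b _ => ?_
  exact (isPosDefKernel_mul_fun fun V : Matrix (Fin N) (Fin N) ℂ => (V a b).re).add
    (isPosDefKernel_mul_fun fun V : Matrix (Fin N) (Fin N) ℂ => (V a b).im)

/-- **The Wilson pure-gauge transfer kernel is positive definite for `β ≥ 0`** (kernel-level
positivity of the transfer operator `T̂_U = e^{−½Ŵ} T̂_K e^{−½Ŵ}` of Smit (4.121), whose kernel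
`⟨U'|T̂_K|U⟩ = ∏ₗ exp[β Re tr(U_l U'_lᴴ)]` is (4.129)). Proof: rewrite
`gaugeSliceKernel β U U' = (f U · f U') · (e^{−3β|E|} · exp(β ∑ₗ Re tr(U_l U'_lᴴ)))` with
`f = exp(−(β/2) S₃)` and `|E|` the number of spatial links; the inner sum is positive definite
(`isPosDefKernel_re_trace_mul_conjTranspose` pulled back along `U ↦ U_l`, summed over `l`), so are
its multiple by `β ≥ 0`, the exponential (BCR 3.1.14), the multiple by the constant `e^{−3β|E|} > 0`,
and the Schur product with the rank-one kernel `f(U) f(U')` (BCR 3.1.9, 3.1.12).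
[cite: Smit2023, §4.6 (4.121)–(4.129)] -/
theorem isPosDefKernel_gaugeSliceKernel : ∀ (S : ℕ) [NeZero S] (β : ℝ), 0 ≤ β → IsPosDefKernel (gaugeSliceKernel (S := S) β) := by
  intro S _ β hβ
  -- the kernel algebra: `K_β(U,U') = (f U · f U') · (e^{−3β|E|} · exp(β ∑ₗ Re tr(U_l U'_lᴴ)))`
  have hK : gaugeSliceKernel (S := S) β =
      fun U U' : GaugeConfig 3 S (Matrix.specialUnitaryGroup (Fin 3) ℂ) =>
        Real.exp (-(β / 2) * wilsonAction (fundamentalRep (Fin 3)) U) *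
            Real.exp (-(β / 2) * wilsonAction (fundamentalRep (Fin 3)) U') *
          (Real.exp (-(3 * β * Fintype.card (Edge 3 S))) *
            Real.exp (β * ∑ l : Edge 3 S,
              ((U l : Matrix (Fin 3) (Fin 3) ℂ) * (U' l : Matrix (Fin 3) (Fin 3) ℂ)ᴴ).trace.re)) := by
    funext U U'
    have h3 : Real.exp (-(β * ∑ l : Edge 3 S, ((3 : ℝ) -
        ((U l : Matrix (Fin 3) (Fin 3) ℂ) * (U' l : Matrix (Fin 3) (Fin 3) ℂ)ᴴ).trace.re))) =
        Real.exp (-(3 * β * Fintype.card (Edge 3 S))) *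
          Real.exp (β * ∑ l : Edge 3 S,
            ((U l : Matrix (Fin 3) (Fin 3) ℂ) * (U' l : Matrix (Fin 3) (Fin 3) ℂ)ᴴ).trace.re) := by
      rw [← Real.exp_add, Finset.sum_sub_distrib, Finset.sum_const, Finset.card_univ, nsmul_eq_mul]
      congr 1
      ring
    rw [gaugeSliceKernel, h3]
    ring
  rw [hK]
  refine (isPosDefKernel_mul_fun _).mul ((IsPosDefKernel.exp ?_).const_mul (Real.exp_pos _).le)
  refine (isPosDefKernel_finsetSum Finset.univ fun l _ => ?_).const_mul hβ
  exact (isPosDefKernel_re_trace_mul_conjTranspose 3).comp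
    fun U : GaugeConfig 3 S (Matrix.specialUnitaryGroup (Fin 3) ℂ) => (U l : Matrix (Fin 3) (Fin 3) ℂ)

end Summit.QuantumFields.QCD.Cruxes.StableActionBridge.Sketch
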